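import Literature.NumberTheory.Rogawski1990.ArchBouazizClassMapG     -- (7) F0 (this seat): `bzClassMapG`, `chartEigG`, `cubicDisc`, `esymm3`, `mem_regG_iff_forall_cubicDisc_ne_zero`
import HarnessLib

/-!
# CLASS TUBES ON THE `G`-ATLAS: the chart-type detector `Δ · conj(σ₃)²`, regularity and ONE chart type near a regular stable class, bounded split coordinates
# (Bouaziz 1994 §5.1 «dans un bon voisinage de chaque élément semi-simple régulier»; Shelstad 1979 §4)

Topic `NumberTheory/Rogawski1990`; namespace `Literature.NumberTheory.Rogawski1990`.  THEOREMS ONLY (no `def`, no instance, no notation, no axiom, no named fact, no `sorry`).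
Cell `pub/hodgecm-mathlib`, crux H413 (`stmt-HodgeConjecture-24833`), road «N8-INNER» (owner LH2-plan (g1)), brick **(7) «(Σ-REG-G)» FILE F1** — the 3 × 3 twin of ★
`ArchBouazizClassTube` (LH3-p04 (g5), p851533∕p851557): the group-free inputs (g1) (g3) (g4) of the (Σ-REG-G) assembly (twin of ★ `bzLocalSurjRegular_of_parts` p851525), read on
the class data `bzClassMapG S′ c = (σ₁, σ₂, σ₃)_w` of F0.  Author LH3-p04 (g7).  Count-neutral.

THE MATHEMATICS.  Every class value of a chart point has a unimodular third entry `σ₃` (product of the eigenvalues: `e^{2iθ}e^{iφ}` at a noncompact place, `e^{i(θ₀+θ₁+θ₂)}` at a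
compact one), and the COMPLEX number `z := cubicDisc(σ) · conj(σ₃)²` (`= Δ ∕ σ₃²` there, `Δ = ∏_{i<j}(λ_i − λ_j)²` by F0 `cubicDisc_esymm3`) is REAL on chart values with a SIGN
that detects the chart type: at a COMPACT place `z = ∏_{i<j} (2 Re(λ_i conj λ_j) − 2) = −64 ∏ sin²((θ_i − θ_j)∕2) ≤ 0`, at a NONCOMPACT place
`z = (eˣ − e⁻ˣ)² · (eˣ + e⁻ˣ − 2 cos(θ − φ))² ≥ 0`, and `z = 0` exactly on the walls (F0: `Δ ≠ 0 ↔` regular).  Hence, near a base class `b` with `Δ(b_w) ≠ 0` at every place,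
all chart points of all charts with class `ε`-near `b` are REGULAR and of ONE chart type (the non-negative and the non-positive reals cannot both be `‖z(b_w)‖∕2`-near the
non-zero `z(b_w)`; if `‖(b w).2.2‖ ≠ 1` no chart value is near at all), and their split coordinates are bounded (`e^{|x|} − 1 ≤ ‖σ₁‖ < ‖(b w).1‖ + ε`).
* §1 invariants: `norm_chartEigG`, `norm_bzClassMapG_snd_snd` (`= 1`), `cubicDisc_mul_conj_sq_of_not_mem` ∕ `…_of_mem` (the two real forms), `compactDetector_le_zero`, `splitDetector_nonneg`;
* §2 tubes: `dist_bzClassMapG_apply_le`, **`exists_forall_mem_regG_of_dist_bzClassMapG_lt`** ((g1) on a tube), `exists_pos_not_split_and_compact_nearG`,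
  **`exists_forall_chart_eq_of_dist_bzClassMapG_lt`** ((g3)), `norm_bzClassMapG_fst_lt_of_dist_lt`, **`abs_coord_zero_le_log_of_dist_bzClassMapG_lt`** ((g4)), and the package
  **`exists_classTubeG`**.
HONEST LABEL: HC_CM is proved only modulo the 7 printed citations (2 remaining: hLiu418 = stmt-HodgeConjecture-24832, h413 = stmt-HodgeConjecture-24833) until rung 0 closes; group-free
chart geometry, pays nothing by itself.

## References
* [Bouaziz1994IntegralesOrbitales] A. Bouaziz, *Intégrales orbitales sur les groupes de Lie réductifs*, Ann. Sci. ÉNS (4) 27 (1994) 573–609, §2.3 p. 578, §5.1 p. 588.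
* [Shelstad1979] D. Shelstad, *Characters and inner forms of a quasi-split group over ℝ*, Compositio Math. 39 (1979), §4 pp. 22–23.
* [Rogawski1990] J. D. Rogawski, *Automorphic Representations of Unitary Groups in Three Variables*, Ann. of Math. Stud. 123 (1990), §3.6 p. 28, §4.3 p. 42.
-/

set_option autoImplicit false

noncomputable section

open Complex Set Function Real Metric
open Literature.NumberTheory.Automorphic Literature.NumberTheory.Automorphic.UnitaryGroup Literature.NumberTheory.Automorphic.ArchCartan
open scoped ComplexConjugate

namespace Literature.NumberTheory.Rogawski1990

variable {W : Type*}

/-! ## §1 The per-place invariants of a class value -/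

section Invariants

variable [DecidableEq W]

/-- `e^{it}` is unimodular. [folklore] -/
private theorem norm_cexp_mul_I (t : ℝ) : ‖Complex.exp ((t : ℂ) * I)‖ = 1 := by
  rw [Complex.norm_exp]
  simp

/-- `e^{it} · conj e^{it} = 1`. [folklore] -/
private theorem cexp_mul_conj (t : ℝ) : Complex.exp ((t : ℂ) * I) * conj (Complex.exp ((t : ℂ) * I)) = 1 := by
  rw [Complex.mul_conj, Complex.normSq_eq_norm_sq, norm_cexp_mul_I, one_pow, ofReal_one]

/-- `eˣ · e⁻ˣ = 1` in `ℂ`. [folklore] -/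
private theorem ofReal_exp_mul_ofReal_exp_neg (x : ℝ) : ((Real.exp x : ℝ) : ℂ) * ((Real.exp (-x) : ℝ) : ℂ) = 1 := by
  rw [← ofReal_mul, ← Real.exp_add, add_neg_cancel, Real.exp_zero, ofReal_one]

/-- **THE PAIR IDENTITY at a compact place**: `(λ − μ)² · conj λ · conj μ = 2 Re(λ conj μ) − 2` for unimodular `λ = e^{ia}`, `μ = e^{ib}` (`= −4 sin²((a−b)∕2)`).
[cite: Shelstad1979, §4 p. 23] -/
theorem sq_sub_mul_conj_eq (a b : ℝ) :
    (Complex.exp ((a : ℂ) * I) - Complex.exp ((b : ℂ) * I)) ^ 2 * (conj (Complex.exp ((a : ℂ) * I)) * conj (Complex.exp ((b : ℂ) * I))) =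
      ((2 * (Complex.exp ((a : ℂ) * I) * conj (Complex.exp ((b : ℂ) * I))).re - 2 : ℝ) : ℂ) := by
  set E : ℂ := Complex.exp ((a : ℂ) * I) with hE
  set F : ℂ := Complex.exp ((b : ℂ) * I) with hF
  have ha : E * conj E = 1 := cexp_mul_conj a
  have hb : F * conj F = 1 := cexp_mul_conj b
  have hre : (((2 * (E * conj F).re : ℝ) : ℂ)) = E * conj F + conj (E * conj F) := (Complex.add_conj _).symm
  rw [ofReal_sub, hre, map_mul, Complex.conj_conj, ofReal_ofNat]
  linear_combination (E * conj F - 2 * (F * conj F)) * ha + (F * conj E - 2) * hb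

/-- The compact pair invariant is a non-positive real (`Re ≤ ‖·‖ = 1`). [cite: Shelstad1979, §4 p. 23] -/
theorem two_mul_re_sub_two_le_zero (a b : ℝ) : 2 * (Complex.exp ((a : ℂ) * I) * conj (Complex.exp ((b : ℂ) * I))).re - 2 ≤ 0 := by
  have h : (Complex.exp ((a : ℂ) * I) * conj (Complex.exp ((b : ℂ) * I))).re ≤ 1 := by
    refine (Complex.re_le_norm _).trans ?_
    rw [norm_mul, Complex.norm_conj, norm_cexp_mul_I, norm_cexp_mul_I, mul_one]
  linarith

/-- **Every eigenvalue of a chart point at a COMPACT place is unimodular.** [cite: Rogawski1990, §3.6 p. 28] -/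
theorem norm_chartEigG_of_not_mem {S' : Finset W} {w : W} (hw : w ∉ S') (c : W → Fin 3 → ℝ) (i : Fin 3) : ‖chartEigG S' c w i‖ = 1 := by
  rw [chartEigG_of_not_mem hw]
  exact norm_cexp_mul_I _

/-- **Every class value has a unimodular third entry**: `‖σ₃‖ = 1` (`σ₃ = e^{2iθ} e^{iφ}` at a noncompact place, `e^{i Σθ}` at a compact one). [cite: Rogawski1990, §3.6 p. 28] -/
theorem norm_bzClassMapG_snd_snd (S' : Finset W) (c : W → Fin 3 → ℝ) (w : W) : ‖(bzClassMapG S' c w).2.2‖ = 1 := by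
  rw [bzClassMapG_apply, esymm3_apply]
  dsimp only
  by_cases hw : w ∈ S'
  · rw [chartEigG_of_mem hw]
    simp only [boostEig, Matrix.cons_val_zero, Matrix.cons_val_one, Matrix.head_cons, Matrix.cons_val_two, Matrix.tail_cons, norm_mul,
      Complex.norm_exp, add_re, neg_re, mul_re, ofReal_re, ofReal_im, I_re, I_im, mul_zero, sub_zero, add_zero, mul_one]
    rw [Real.exp_zero, mul_one, ← Real.exp_add, add_neg_cancel, Real.exp_zero]
  · rw [norm_mul, norm_mul, norm_chartEigG_of_not_mem hw, norm_chartEigG_of_not_mem hw, norm_chartEigG_of_not_mem hw, mul_one, mul_one]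

/-- **THE DETECTOR AT A COMPACT PLACE**: `Δ · conj(σ₃)² = ∏_{i<j} (2 Re(λ_i conj λ_j) − 2)`, a product of three non-positive reals. [cite: Shelstad1979, §4 p. 23]
[cite: Bouaziz1994IntegralesOrbitales, §5.1 p. 588] -/
theorem cubicDisc_mul_conj_sq_of_not_mem {S' : Finset W} {w : W} (hw : w ∉ S') (c : W → Fin 3 → ℝ) :
    cubicDisc (bzClassMapG S' c w) * conj ((bzClassMapG S' c w).2.2) ^ 2 =
      (((2 * (Complex.exp ((c w 0 : ℂ) * I) * conj (Complex.exp ((c w 1 : ℂ) * I))).re - 2) *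
          (2 * (Complex.exp ((c w 0 : ℂ) * I) * conj (Complex.exp ((c w 2 : ℂ) * I))).re - 2) *
            (2 * (Complex.exp ((c w 1 : ℂ) * I) * conj (Complex.exp ((c w 2 : ℂ) * I))).re - 2) : ℝ) : ℂ) := by
  rw [bzClassMapG_apply, cubicDisc_esymm3]
  simp only [esymm3_apply, chartEigG_of_not_mem hw]
  rw [ofReal_mul, ofReal_mul, ← sq_sub_mul_conj_eq (c w 0) (c w 1), ← sq_sub_mul_conj_eq (c w 0) (c w 2), ← sq_sub_mul_conj_eq (c w 1) (c w 2)]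
  simp only [map_mul]
  ring

/-- **THE DETECTOR AT A NONCOMPACT PLACE**: `Δ · conj(σ₃)² = (eˣ − e⁻ˣ)² · (eˣ + e⁻ˣ − 2 cos(θ − φ))²` (`x = c w 0`, `φ = c w 1`, `θ = c w 2`), a non-negative real.
[cite: Shelstad1979, §4 p. 23] [cite: Bouaziz1994IntegralesOrbitales, §5.1 p. 588] -/
theorem cubicDisc_mul_conj_sq_of_mem {S' : Finset W} {w : W} (hw : w ∈ S') (c : W → Fin 3 → ℝ) :
    cubicDisc (bzClassMapG S' c w) * conj ((bzClassMapG S' c w).2.2) ^ 2 =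
      (((Real.exp (c w 0) - Real.exp (-(c w 0))) ^ 2 * (Real.exp (c w 0) + Real.exp (-(c w 0)) - 2 * Real.cos (c w 2 - c w 1)) ^ 2 : ℝ) : ℂ) := by
  rw [bzClassMapG_apply, cubicDisc_esymm3]
  simp only [esymm3_apply, chartEigG_of_mem hw, boostEig_eq_mul, Matrix.cons_val_zero, Matrix.cons_val_one, Matrix.head_cons, Matrix.cons_val_two,
    Matrix.tail_cons]
  push_cast
  -- atoms: `R = eˣ`, `R' = e⁻ˣ` (real, `R R' = 1`), `T = e^{iθ}`, `F = e^{iφ}` (unit circle)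
  set R : ℂ := Complex.exp (c w 0 : ℂ) with hR
  set R' : ℂ := Complex.exp (-(c w 0 : ℂ)) with hR'
  set T : ℂ := Complex.exp ((c w 2 : ℂ) * I) with hT
  set F : ℂ := Complex.exp ((c w 1 : ℂ) * I) with hF
  have hRR : R * R' = 1 := by rw [hR, hR', ← Complex.exp_add, add_neg_cancel, Complex.exp_zero]
  have hTT : T * conj T = 1 := cexp_mul_conj _
  have hFF : F * conj F = 1 := cexp_mul_conj _
  have hconjR : conj R = R := by rw [hR, ← Complex.exp_conj, Complex.conj_ofReal]
  have hconjR' : conj R' = R' := by rw [hR', ← Complex.exp_conj, map_neg, Complex.conj_ofReal]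
  have hconjF : conj F = Complex.exp (-((c w 1 : ℂ) * I)) := by
    rw [hF, ← Complex.exp_conj, map_mul, Complex.conj_ofReal, Complex.conj_I, mul_neg]
  have hconjT' : conj T = Complex.exp (-((c w 2 : ℂ) * I)) := by
    rw [hT, ← Complex.exp_conj, map_mul, Complex.conj_ofReal, Complex.conj_I, mul_neg]
  have hcos : Complex.cos ((c w 2 : ℂ) - (c w 1 : ℂ)) = (T * conj F + conj T * F) / 2 := by
    have e1 : ((c w 2 : ℂ) - (c w 1 : ℂ)) * I = (c w 2 : ℂ) * I + -((c w 1 : ℂ) * I) := by ring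
    have e2 : -((c w 2 : ℂ) - (c w 1 : ℂ)) * I = -((c w 2 : ℂ) * I) + (c w 1 : ℂ) * I := by ring
    rw [Complex.cos, hconjF, hconjT', hT, hF, ← Complex.exp_add, ← Complex.exp_add, e1, e2]
  -- the mixed pair product `(RT − F)(F − R′T) = −T F ((T conj F + conj T F) − (R + R′))`
  have hQ : (R * T - F) * (F - R' * T) = -(T * F * ((T * conj F + conj T * F) - (R + R'))) := by
    linear_combination (-(T ^ 2)) * hRR + T ^ 2 * hFF + F ^ 2 * hTT
  rw [hcos]
  simp only [map_mul, hconjR, hconjR']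
  calc ((R * T - F) * (R * T - R' * T) * (F - R' * T)) ^ 2 * (R * conj T * conj F * (R' * conj T)) ^ 2
      = ((R - R') * ((R * T - F) * (F - R' * T)) * (T * conj T) * (R * R') * conj T * conj F) ^ 2 := by ring
    _ = ((R - R') * (-(T * F * ((T * conj F + conj T * F) - (R + R')))) * 1 * 1 * conj T * conj F) ^ 2 := by rw [hQ, hTT, hRR]
    _ = ((R - R') * ((T * conj F + conj T * F) - (R + R')) * (T * conj T) * (F * conj F)) ^ 2 := by ring
    _ = ((R - R') * ((T * conj F + conj T * F) - (R + R')) * 1 * 1) ^ 2 := by rw [hTT, hFF]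
    _ = (R - R') ^ 2 * (R + R' - 2 * ((T * conj F + conj T * F) / 2)) ^ 2 := by ring

/-- The compact detector is non-positive: a product of three non-positive reals. [cite: Shelstad1979, §4 p. 23] -/
theorem compactDetector_le_zero (a₀ a₁ a₂ : ℝ) :
    (2 * (Complex.exp ((a₀ : ℂ) * I) * conj (Complex.exp ((a₁ : ℂ) * I))).re - 2) *
        (2 * (Complex.exp ((a₀ : ℂ) * I) * conj (Complex.exp ((a₂ : ℂ) * I))).re - 2) *
          (2 * (Complex.exp ((a₁ : ℂ) * I) * conj (Complex.exp ((a₂ : ℂ) * I))).re - 2) ≤ 0 := by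
  have h01 := two_mul_re_sub_two_le_zero a₀ a₁
  have h02 := two_mul_re_sub_two_le_zero a₀ a₂
  have h12 := two_mul_re_sub_two_le_zero a₁ a₂
  have h : 0 ≤ (2 * (Complex.exp ((a₀ : ℂ) * I) * conj (Complex.exp ((a₁ : ℂ) * I))).re - 2) *
      (2 * (Complex.exp ((a₀ : ℂ) * I) * conj (Complex.exp ((a₂ : ℂ) * I))).re - 2) := mul_nonneg_of_nonpos_of_nonpos h01 h02
  exact mul_nonpos_of_nonneg_of_nonpos h h12

/-- The split detector is non-negative. [cite: Shelstad1979, §4 p. 23] -/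
theorem splitDetector_nonneg (x φ θ : ℝ) : 0 ≤ (Real.exp x - Real.exp (-x)) ^ 2 * (Real.exp x + Real.exp (-x) - 2 * Real.cos (θ - φ)) ^ 2 :=
  mul_nonneg (sq_nonneg _) (sq_nonneg _)

end Invariants


/-! ## §2 Class tubes around a base class -/

section Tubes

variable [Fintype W] [DecidableEq W]

omit [DecidableEq W] in
/-- A positive lower bound for finitely many positive radii. [folklore] -/
private theorem exists_pos_forall_le (δ : W → ℝ) (hδ : ∀ w, 0 < δ w) : ∃ ε : ℝ, 0 < ε ∧ ∀ w, ε ≤ δ w := by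
  cases isEmpty_or_nonempty W with
  | inl h => exact ⟨1, one_pos, fun w => isEmptyElim w⟩
  | inr h =>
    obtain ⟨w₀, hw₀⟩ := Finite.exists_min δ
    exact ⟨δ w₀, hδ w₀, hw₀⟩

/-- The class tube controls each place: `dist (bzClassMapG S′ c w) (b w) ≤ dist (bzClassMapG S′ c) b` (sup metric over the places). [cite: Bouaziz1994IntegralesOrbitales, §5.1 p. 588] -/
theorem dist_bzClassMapG_apply_le (S' : Finset W) (c : W → Fin 3 → ℝ) (b : W → ℂ × ℂ × ℂ) (w : W) :
    dist (bzClassMapG S' c w) (b w) ≤ dist (bzClassMapG S' c) b :=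
  dist_le_pi_dist _ _ w

/-- The cubic discriminant is continuous on the class-data space. [cite: Rogawski1990, §4.3 p. 42] -/
theorem continuous_cubicDisc : Continuous fun P : ℂ × ℂ × ℂ => cubicDisc P := by
  simp only [cubicDisc]
  fun_prop

/-- **(g1) REGULARITY ON THE TUBE**: near a base class `b` with `Δ(b_w) ≠ 0` at every place, every chart point of every chart whose class is `ε`-near `b` is regular (`Δ` is
continuous and non-zero at `b w`; F0 `mem_regG_iff_forall_cubicDisc_ne_zero`). [cite: Bouaziz1994IntegralesOrbitales, §5.1 p. 588] [cite: Shelstad1979, §4 p. 22] -/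
theorem exists_forall_mem_regG_of_dist_bzClassMapG_lt (b : W → ℂ × ℂ × ℂ) (hb : ∀ w, cubicDisc (b w) ≠ 0) :
    ∃ ε : ℝ, 0 < ε ∧ ∀ (S' : Finset W) (c : W → Fin 3 → ℝ), dist (bzClassMapG S' c) b < ε → c ∈ RegG S' := by
  have hδ : ∀ w, ∃ δ : ℝ, 0 < δ ∧ ∀ P : ℂ × ℂ × ℂ, dist P (b w) < δ → cubicDisc P ≠ 0 := by
    intro w
    have hev := (continuous_cubicDisc.continuousAt (x := b w)).eventually_ne (hb w)
    obtain ⟨δ, hδ, hball⟩ := Metric.eventually_nhds_iff.1 hev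
    exact ⟨δ, hδ, fun P hP => hball hP⟩
  choose δ hδ hδP using hδ
  obtain ⟨ε, hε, hεδ⟩ := exists_pos_forall_le δ hδ
  refine ⟨ε, hε, fun S' c hc => (mem_regG_iff_forall_cubicDisc_ne_zero S' c).2 fun w => hδP w _ ?_⟩
  exact ((dist_bzClassMapG_apply_le S' c b w).trans_lt hc).trans_le (hεδ w)

omit [Fintype W] in
/-- **(g3) ONE CHART TYPE PER PLACE near a regular value**: for `P₀ : ℂ × ℂ × ℂ` with `Δ(P₀) ≠ 0` there is `δ > 0` such that no NONCOMPACT-type value and COMPACT-type value of the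
class map at the same place are both `δ`-near `P₀` (if `‖P₀.2.2‖ ≠ 1` no class value is near at all, §1 `norm_bzClassMapG_snd_snd`; otherwise `z := Δ(P₀) · conj(P₀.2.2)² ≠ 0` and the
two REAL detectors, `≥ 0` and `≤ 0` (§1), cannot both be `‖z‖∕2`-near `z`). [cite: Bouaziz1994IntegralesOrbitales, §5.1 p. 588] [cite: Shelstad1979, §4 p. 23] -/
theorem exists_pos_not_split_and_compact_nearG (P₀ : ℂ × ℂ × ℂ) (h : cubicDisc P₀ ≠ 0) :
    ∃ δ : ℝ, 0 < δ ∧ ∀ (S S' : Finset W) (c c' : W → Fin 3 → ℝ) (w : W), w ∈ S → w ∉ S' →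
      dist (bzClassMapG S c w) P₀ < δ → dist (bzClassMapG S' c' w) P₀ < δ → False := by
  by_cases hd : ‖P₀.2.2‖ = 1
  · -- `z := Δ(P₀) conj(σ₃)² ≠ 0`
    set z : ℂ := cubicDisc P₀ * conj (P₀.2.2) ^ 2 with hz_def
    have hσ : conj (P₀.2.2) ≠ 0 := by
      rw [map_ne_zero_iff _ (RingHom.injective _)]
      intro h0
      rw [h0, norm_zero] at hd
      exact zero_ne_one hd
    have hz : z ≠ 0 := mul_ne_zero h (pow_ne_zero _ hσ)
    have hzpos : 0 < ‖z‖ / 2 := by positivity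
    have hcont : Continuous fun P : ℂ × ℂ × ℂ => cubicDisc P * conj (P.2.2) ^ 2 :=
      continuous_cubicDisc.mul ((Complex.continuous_conj.comp (continuous_snd.comp continuous_snd)).pow 2)
    have hev : ∀ᶠ P in nhds P₀, dist (cubicDisc P * conj (P.2.2) ^ 2) z < ‖z‖ / 2 := by
      have ht : Filter.Tendsto (fun P : ℂ × ℂ × ℂ => cubicDisc P * conj (P.2.2) ^ 2) (nhds P₀) (nhds z) := hcont.continuousAt
      exact ht.eventually (Metric.ball_mem_nhds z hzpos)
    obtain ⟨δ, hδ, hball⟩ := Metric.eventually_nhds_iff.1 hev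
    refine ⟨δ, hδ, fun S S' c c' w hw hw' hP hQ => ?_⟩
    have hP' := hball hP
    have hQ' := hball hQ
    rw [cubicDisc_mul_conj_sq_of_mem hw] at hP'
    rw [cubicDisc_mul_conj_sq_of_not_mem hw'] at hQ'
    set r : ℝ := (Real.exp (c w 0) - Real.exp (-(c w 0))) ^ 2 * (Real.exp (c w 0) + Real.exp (-(c w 0)) - 2 * Real.cos (c w 2 - c w 1)) ^ 2 with hr_def
    set s : ℝ := (2 * (Complex.exp ((c' w 0 : ℂ) * I) * conj (Complex.exp ((c' w 1 : ℂ) * I))).re - 2) *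
        (2 * (Complex.exp ((c' w 0 : ℂ) * I) * conj (Complex.exp ((c' w 2 : ℂ) * I))).re - 2) *
          (2 * (Complex.exp ((c' w 1 : ℂ) * I) * conj (Complex.exp ((c' w 2 : ℂ) * I))).re - 2) with hs_def
    have hr : 0 ≤ r := splitDetector_nonneg _ _ _
    have hs : s ≤ 0 := compactDetector_le_zero _ _ _
    rw [dist_eq_norm] at hP' hQ'
    have h1 : ‖z‖ < ‖z‖ / 2 + r := by
      have hnr : ‖(r : ℂ)‖ = r := by rw [Complex.norm_real, Real.norm_eq_abs, abs_of_nonneg hr]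
      have hsym : ‖z - (r : ℂ)‖ = ‖(r : ℂ) - z‖ := norm_sub_rev _ _
      linarith [norm_sub_norm_le z (r : ℂ)]
    have h2 : ‖z‖ < ‖z‖ / 2 - s := by
      have hns : ‖(s : ℂ)‖ = -s := by rw [Complex.norm_real, Real.norm_eq_abs, abs_of_nonpos hs]
      have hsym : ‖z - (s : ℂ)‖ = ‖(s : ℂ) - z‖ := norm_sub_rev _ _
      linarith [norm_sub_norm_le z (s : ℂ)]
    have h3 : r - s < ‖z‖ := by
      have hrs : ‖((r : ℂ)) - (s : ℂ)‖ = r - s := by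
        rw [← ofReal_sub, Complex.norm_real, Real.norm_eq_abs, abs_of_nonneg (by linarith)]
      have htri : ‖((r : ℂ)) - (s : ℂ)‖ ≤ ‖(r : ℂ) - z‖ + ‖z - (s : ℂ)‖ := norm_sub_le_norm_sub_add_norm_sub _ _ _
      have hsym : ‖z - (s : ℂ)‖ = ‖(s : ℂ) - z‖ := norm_sub_rev _ _
      linarith
    linarith
  · -- `‖σ₃(P₀)‖ ≠ 1`: no class value is `|‖σ₃(P₀)‖ − 1|`-near `P₀`
    refine ⟨|‖P₀.2.2‖ - 1|, abs_pos.2 (sub_ne_zero.2 hd), fun S S' c c' w _ _ hP _ => ?_⟩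
    have h1 : dist (bzClassMapG S c w).2.2 P₀.2.2 ≤ dist (bzClassMapG S c w) P₀ :=
      calc dist (bzClassMapG S c w).2.2 P₀.2.2 ≤ dist (bzClassMapG S c w).2 P₀.2 := by
            rw [Prod.dist_eq (x := (bzClassMapG S c w).2)]; exact le_max_right _ _
        _ ≤ dist (bzClassMapG S c w) P₀ := by rw [Prod.dist_eq (x := bzClassMapG S c w)]; exact le_max_right _ _
    have h2 : |‖P₀.2.2‖ - 1| ≤ dist (bzClassMapG S c w).2.2 P₀.2.2 := by
      rw [dist_eq_norm, ← norm_bzClassMapG_snd_snd S c w, abs_sub_comm]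
      exact abs_norm_sub_norm_le _ _
    linarith

/-- **(g3) ONE CHART NEAR A REGULAR BASE CLASS**: near `b` with `Δ(b_w) ≠ 0` at every place, all chart points of ALL charts whose class is `ε`-near `b` belong to ONE AND THE SAME
chart `S′` (the compact-type and the noncompact-type images meet only on the walls `Δ = 0`; off every image the statement is vacuous).
[cite: Bouaziz1994IntegralesOrbitales, §5.1 p. 588] [cite: Shelstad1979, §4 pp. 22–23] -/
theorem exists_forall_chart_eq_of_dist_bzClassMapG_lt (b : W → ℂ × ℂ × ℂ) (hb : ∀ w, cubicDisc (b w) ≠ 0) :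
    ∃ ε : ℝ, 0 < ε ∧ ∀ (S S' : Finset W) (c c' : W → Fin 3 → ℝ),
      dist (bzClassMapG S c) b < ε → dist (bzClassMapG S' c') b < ε → S = S' := by
  choose δ hδ hδP using fun w => exists_pos_not_split_and_compact_nearG (W := W) (b w) (hb w)
  obtain ⟨ε, hε, hεδ⟩ := exists_pos_forall_le δ hδ
  refine ⟨ε, hε, fun S S' c c' hc hc' => Finset.ext fun w => ?_⟩
  have hw1 : dist (bzClassMapG S c w) (b w) < δ w := ((dist_bzClassMapG_apply_le S c b w).trans_lt hc).trans_le (hεδ w)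
  have hw2 : dist (bzClassMapG S' c' w) (b w) < δ w := ((dist_bzClassMapG_apply_le S' c' b w).trans_lt hc').trans_le (hεδ w)
  constructor
  · intro h1
    by_contra h2
    exact hδP w S S' c c' w h1 h2 hw1 hw2
  · intro h2
    by_contra h1
    exact hδP w S' S c' c w h2 h1 hw2 hw1

omit [Fintype W] in
/-- `e^{|x|} ≤ eˣ + e⁻ˣ`. [folklore] -/
private theorem exp_abs_le_exp_add_exp_neg (x : ℝ) : Real.exp |x| ≤ Real.exp x + Real.exp (-x) := by
  rcases le_or_gt 0 x with hx | hx
  · rw [abs_of_nonneg hx]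
    linarith [Real.exp_pos (-x)]
  · rw [abs_of_neg hx]
    linarith [Real.exp_pos x]

omit [Fintype W] in
/-- **The modulus of `σ₁` at a NONCOMPACT place**: `eˣ + e⁻ˣ − 1 ≤ ‖σ₁‖` (`σ₁ = (eˣ + e⁻ˣ) e^{iθ} + e^{iφ}`, reverse triangle inequality). [cite: Rogawski1990, §3.6 p. 28] -/
theorem exp_add_exp_neg_sub_one_le_norm_fst_of_mem {S' : Finset W} {w : W} (hw : w ∈ S') (c : W → Fin 3 → ℝ) :
    Real.exp (c w 0) + Real.exp (-(c w 0)) - 1 ≤ ‖(bzClassMapG S' c w).1‖ := by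
  rw [bzClassMapG_apply, esymm3_apply, chartEigG_of_mem hw, boostEig_eq_mul]
  simp only [Matrix.cons_val_zero, Matrix.cons_val_one, Matrix.head_cons, Matrix.cons_val_two, Matrix.tail_cons]
  -- `σ₁ = A + F` with `‖A‖ = eˣ + e⁻ˣ`, `‖F‖ = 1`
  set A : ℂ := Complex.exp (c w 0 : ℂ) * Complex.exp ((c w 2 : ℂ) * I) + Complex.exp (-(c w 0 : ℂ)) * Complex.exp ((c w 2 : ℂ) * I) with hA
  set F : ℂ := Complex.exp ((c w 1 : ℂ) * I) with hF
  have hAF : Complex.exp (c w 0 : ℂ) * Complex.exp ((c w 2 : ℂ) * I) + F + Complex.exp (-(c w 0 : ℂ)) * Complex.exp ((c w 2 : ℂ) * I) = A + F := by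
    rw [hA]; ring
  have hnA : ‖A‖ = Real.exp (c w 0) + Real.exp (-(c w 0)) := by
    rw [hA, ← add_mul, norm_mul, norm_cexp_mul_I, mul_one, ← Complex.ofReal_exp, ← ofReal_neg, ← Complex.ofReal_exp, ← ofReal_add, Complex.norm_real,
      Real.norm_eq_abs, abs_of_pos (add_pos (Real.exp_pos _) (Real.exp_pos _))]
  have hnF : ‖F‖ = 1 := norm_cexp_mul_I _
  rw [hAF]
  have h := norm_sub_norm_le A (-F)
  rw [sub_neg_eq_add, norm_neg, hnA, hnF] at h
  linarith

/-- The `σ₁` entry is controlled by the class tube: `‖σ₁‖ < ‖(b w).1‖ + ε`. [cite: Bouaziz1994IntegralesOrbitales, §5.1 p. 588] -/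
theorem norm_bzClassMapG_fst_lt_of_dist_lt (S' : Finset W) (c : W → Fin 3 → ℝ) (b : W → ℂ × ℂ × ℂ) {ε : ℝ} (w : W)
    (h : dist (bzClassMapG S' c) b < ε) : ‖(bzClassMapG S' c w).1‖ < ‖(b w).1‖ + ε := by
  have h1 : dist (bzClassMapG S' c w).1 (b w).1 < ε :=
    calc dist (bzClassMapG S' c w).1 (b w).1 ≤ dist (bzClassMapG S' c w) (b w) := by
          rw [Prod.dist_eq (x := bzClassMapG S' c w)]; exact le_max_left _ _
      _ ≤ dist (bzClassMapG S' c) b := dist_bzClassMapG_apply_le S' c b w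
      _ < ε := h
  have h2 := norm_sub_norm_le (bzClassMapG S' c w).1 (b w).1
  rw [← dist_eq_norm] at h2
  linarith

/-- **(g4) BOUNDED NONCOMPACT COORDINATES ON A TUBE**: if the class of `(S′, c)` is `ε`-near `b` then `|x_w| ≤ log (‖(b w).1‖ + ε + 2)` at every noncompact place `w ∈ S′`
(`e^{|x|} ≤ eˣ + e⁻ˣ ≤ ‖σ₁‖ + 1 < ‖(b w).1‖ + ε + 1`). [cite: Bouaziz1994IntegralesOrbitales, §5.1 p. 588] [cite: Rogawski1990, §3.6 p. 28] -/
theorem abs_coord_zero_le_log_of_dist_bzClassMapG_lt (S' : Finset W) (c : W → Fin 3 → ℝ) (b : W → ℂ × ℂ × ℂ) (ε : ℝ) (w : W) (hw : w ∈ S')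
    (h : dist (bzClassMapG S' c) b < ε) : |c w 0| ≤ Real.log (‖(b w).1‖ + ε + 2) := by
  have h1 := norm_bzClassMapG_fst_lt_of_dist_lt S' c b w h
  have h0 := exp_add_exp_neg_sub_one_le_norm_fst_of_mem hw c
  have h2 : Real.exp |c w 0| < ‖(b w).1‖ + ε + 2 := by linarith [exp_abs_le_exp_add_exp_neg (c w 0)]
  have hpos : 0 < ‖(b w).1‖ + ε + 2 := (Real.exp_pos _).trans h2
  rw [Real.le_log_iff_exp_le hpos]
  exact h2.le

/-- **BOUNDED NONCOMPACT COORDINATES ON THE UNIT TUBE, uniform in the place**: `|x_w| ≤ log (‖b‖ + 3)`. [cite: Bouaziz1994IntegralesOrbitales, §5.1 p. 588] -/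
theorem abs_coord_zero_le_log_norm_of_dist_bzClassMapG_lt_one (b : W → ℂ × ℂ × ℂ) {S' : Finset W} {c : W → Fin 3 → ℝ} (h : dist (bzClassMapG S' c) b < 1)
    {w : W} (hw : w ∈ S') : |c w 0| ≤ Real.log (‖b‖ + 3) := by
  refine (abs_coord_zero_le_log_of_dist_bzClassMapG_lt S' c b 1 w hw h).trans (Real.log_le_log (by positivity) ?_)
  have h3 : ‖(b w).1‖ ≤ ‖b‖ := (norm_fst_le (b w)).trans (norm_le_pi_norm b w)
  linarith

/-- **THE CLASS TUBE PACKAGE at a regular base class** (consumed by the (Σ-REG-G) assembly F7): one radius `ε ∈ (0, 1]` below which (i) every chart point with class `ε`-near `b`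
is regular with noncompact coordinates bounded by `log (‖b‖ + 3)`, and (ii) all such chart points belong to one chart. [cite: Bouaziz1994IntegralesOrbitales, §5.1 p. 588]
[cite: Shelstad1979, §4 pp. 22–23] -/
theorem exists_classTubeG (b : W → ℂ × ℂ × ℂ) (hb : ∀ w, cubicDisc (b w) ≠ 0) :
    ∃ ε : ℝ, 0 < ε ∧ ε ≤ 1 ∧
      (∀ (S' : Finset W) (c : W → Fin 3 → ℝ), dist (bzClassMapG S' c) b < ε → c ∈ RegG S' ∧ ∀ w ∈ S', |c w 0| ≤ Real.log (‖b‖ + 3)) ∧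
      ∀ (S S' : Finset W) (c c' : W → Fin 3 → ℝ), dist (bzClassMapG S c) b < ε → dist (bzClassMapG S' c') b < ε → S = S' := by
  obtain ⟨ε₁, hε₁, h₁⟩ := exists_forall_mem_regG_of_dist_bzClassMapG_lt b hb
  obtain ⟨ε₂, hε₂, h₂⟩ := exists_forall_chart_eq_of_dist_bzClassMapG_lt b hb
  refine ⟨min 1 (min ε₁ ε₂), lt_min one_pos (lt_min hε₁ hε₂), min_le_left _ _, fun S' c hc => ⟨h₁ S' c ?_, fun w hw => ?_⟩, fun S S' c c' hc hc' => h₂ S S' c c' ?_ ?_⟩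
  · exact hc.trans_le ((min_le_right _ _).trans (min_le_left _ _))
  · exact abs_coord_zero_le_log_norm_of_dist_bzClassMapG_lt_one b (hc.trans_le (min_le_left _ _)) hw
  · exact hc.trans_le ((min_le_right _ _).trans (min_le_right _ _))
  · exact hc'.trans_le ((min_le_right _ _).trans (min_le_right _ _))

end Tubes

end Literature.NumberTheory.Rogawski1990

end
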